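import Summits.CriticalPhenomena.PercolationContinuityZ3.Theorems.Transplant.FKConnectivityAllQForestAdjacentDegThree
import Summits.CriticalPhenomena.PercolationContinuityZ3.Theorems.Transplant.FKConnectivityAllQForestAdjacentCutVertex
import Summits.CriticalPhenomena.PercolationContinuityZ3.Theorems.Transplant.FKConnectivityAllQForestAdjacentPathGadgetReglue
import HarnessLib

/-!
# The square-free adjacent forest Rayleigh inequality HOLDS for two edges of a triangle (all multigraphs, all fibres through `vy`)

Support file (`--supports stmt-CriticalPhenomena-4575`), FK sub-lane `prim-bschramm-fk-1` (gen 21) of the post-continuity programme;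
builds on p205010 (kernel theorem, internal audit signed; external expert review pending).  No definitions, no named facts, no sorries;
standard axioms.

THE NODE (`AdjForestRayleighNoSqOn`, fk-1 g16, `…TwoClusterRayleighNoSq.lean`): for `e = ov ≠ f = oy` and every fibre `(M, u₀)`,
`#(Fo ∩ {e, f ∈ ω}, Fo) ≤ #(Fo ∩ {e ∈ ω}, Fo ∩ {f ∈ ω})`; equivalently, in a uniformly random ordered partition `(A, B)` of the
pairs of a finite multigraph into two forests, `P(e, f in the same class) ≤ 1/2` for two pairs at a common vertex (memo
bschramm/FROM-fk-1-g18-VERTEX-NC.md).  Known positive cases in the tree: `deg o ≤ 3` (`…DegThree`), `o` a cut vertex / dense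
separators (equalities), 2-sums, `Fin 4`.

THIS FILE (method of gen 21: injections `Same → Different` that COMMUTE WITH THE CLASS SWAP `σ : (A, B) ↦ (B, A)`; a map
`Φ : Bad → Good₁ ∪ Good₂` whose image contains no `σ`-pair suffices, `Good₁ = {e ∈ A, f ∈ B}`, `Good₂ = σ Good₁`) proves the node's
inequality on EVERY fibre whose pair set contains the third side `g = vy` of the triangle `o, v, y`:
* tools: **`not_reachable_sdiff_of_two_mem`** (a forest through `ov, oy` minus `oy` separates `v` from `y`),
  **`not_reachable_both_sdiff`** (a forest through `vy` minus `vy`: no vertex reaches both `v` and `y`),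
  **`not_mem_of_isForestCfg_of_two_mem`** (no forest holds a triangle), three set identities for the exchange `ω ↦ (ω ∖ {f}) ∪ {g}`;
* **`adjForestNoSq_fibre_of_triangle_mem`** (`e, f, g ∈ M`, `o, v, y` distinct): `g` lies in the partner class `B = ω ∆ M`; the
  exchange `f ↔ g` (when `o ↮ y` in `B ∖ {g}`) resp. `e ↔ g` (otherwise; then `o ↮ v` in `B ∖ {g}`) is an injection of the bad pairs
  into `{e, g ∈ A, f ∈ B} ⊔ {f, g ∈ A, e ∈ B}`, and the swap `σ` carries the second set onto `{e ∈ A, g ∉ A, f ∈ B}` — so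
  `bad ≤ #(Fo ∩ {e ∈ ω} ∩ {g ∈ ω}, Fo ∩ {f ∈ ω}) + #(Fo ∩ {e ∈ ω} ∩ {g ∉ ω}, Fo ∩ {f ∈ ω}) = good`;
* **`adjForestNoSq_fibre_of_triangle`**: the node's inequality on every fibre `(M, u₀)` with `s(v, y) ∈ M ∪ u₀` (the loop /
  absent-pair / doubled-pair cases are `0 ≤ ·` or equalities as in `adjForestRayleighNoSqOn_of_split`; `g ∈ u₀` makes `bad = 0`).
So two pairs of a triangle are negatively correlated in the uniform ordered two-forest partition of EVERY finite multigraph; in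
polynomial language, the part of the forest Rayleigh difference `F_e^f F_f^e − F_{ef} F^{ef}` of a graph `G ∋ ov, oy, vy` that is
divisible by `x_{vy}` has nonnegative coefficients (the remaining part is the Rayleigh difference of `G − vy`, i.e. the general node).
Not in print as searched (presearch in the seat notes): Semple–Welsh prove the all-pairs coefficientwise statement exactly for
graphs with no `K₄` minor; the triangle case here has no minor hypothesis.
[cite: SempleWelsh2008, Conj. 1.1 (p. 2); Thm. 4.2 (p. 11)] [cite: CibulkaHladkyLaCroixWagner2008, Thm. 1 (p. 2)] [cite: Linusson2011, Prop. 2.6]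
[cite: Grimmett2006, §1.5 (p. 13)]
-/

noncomputable section

namespace Summit.CriticalPhenomena.PercolationContinuityZ3.Theorems
namespace FK

open MeasureTheory Set Literature.Probability.LatticeModels Literature.Probability.Percolation
open scoped Classical symmDiff

variable {V : Type*} [Fintype V]

/-! ### Forest facts around a triangle -/

section Tools

variable {ω : BondConfig V} {o v y : V}

omit [Fintype V] in
/-- **A forest through `ov` and `oy`, minus `oy`, separates `v` from `y`** (else `o ~ v ~ y` off `oy` and `oy` closes a cycle).
[cite: Grimmett2006, §1.5 (p. 13)] -/
theorem not_reachable_sdiff_of_two_mem (hov : o ≠ v) (hoy : o ≠ y) (hvy : v ≠ y) (hF : IsForestCfg ω)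
    (he : s(o, v) ∈ ω) (hf : s(o, y) ∈ ω) : ¬ (openGraph (ω \ {s(o, y)})).Reachable v y := by
  intro h
  have hef : s(o, v) ≠ s(o, y) := fun h' => hvy (Sym2.congr_right.1 h')
  have he' : s(o, v) ∈ ω \ {s(o, y)} := ⟨he, hef⟩
  have hf' : s(o, y) ∉ ω \ {s(o, y)} := fun h' => h'.2 rfl
  have hov' : (openGraph (ω \ {s(o, y)})).Reachable o v := ((openGraph_adj _ _ _).2 ⟨he', hov⟩).reachable
  have hback : insert s(o, y) (ω \ {s(o, y)}) = ω := by rw [insert_sdiff_singleton, insert_eq_of_mem hf]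
  have hF' : IsForestCfg (insert s(o, y) (ω \ {s(o, y)})) := by rwa [hback]
  exact ((isForestCfg_insert_iff hoy hf').1 hF').2 (hov'.trans h)

omit [Fintype V] in
/-- **A forest through `vy`, minus `vy`: no vertex reaches both `v` and `y`.** [cite: Grimmett2006, §1.5 (p. 13)] -/
theorem not_reachable_both_sdiff (hvy : v ≠ y) (hF : IsForestCfg ω) (hg : s(v, y) ∈ ω)
    (hv : (openGraph (ω \ {s(v, y)})).Reachable o v) (hy : (openGraph (ω \ {s(v, y)})).Reachable o y) : False := by
  have hg' : s(v, y) ∉ ω \ {s(v, y)} := fun h' => h'.2 rfl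
  have hback : insert s(v, y) (ω \ {s(v, y)}) = ω := by rw [insert_sdiff_singleton, insert_eq_of_mem hg]
  have hF' : IsForestCfg (insert s(v, y) (ω \ {s(v, y)})) := by rwa [hback]
  exact ((isForestCfg_insert_iff hvy hg').1 hF').2 (hv.symm.trans hy)

omit [Fintype V] in
/-- **No forest holds a triangle**: `ov, oy ∈ ω ∈ Fo ⇒ vy ∉ ω`. [cite: Grimmett2006, §1.5 (p. 13)] -/
theorem not_mem_of_isForestCfg_of_two_mem (hov : o ≠ v) (hoy : o ≠ y) (hvy : v ≠ y) (hF : IsForestCfg ω)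
    (he : s(o, v) ∈ ω) (hf : s(o, y) ∈ ω) : s(v, y) ∉ ω := by
  intro hg
  have hg' : s(v, y) ∈ ω \ {s(o, y)} := ⟨hg, fun h' => hov (Sym2.congr_left.1 h').symm⟩
  exact not_reachable_sdiff_of_two_mem hov hoy hvy hF he hf ((openGraph_adj _ _ _).2 ⟨hg', hvy⟩).reachable

end Tools

/-! ### Set identities for the exchange `ω ↦ (ω ∖ {f}) ∪ {g}` -/

section Exchange

variable {ω M : BondConfig V} {f g : Sym2 V}

omit [Fintype V] in
/-- The exchange keeps the fibre: `((ω ∖ {f}) ∪ {g}) ∖ M = ω ∖ M` for `f, g ∈ M`. [folklore] -/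
theorem insert_sdiff_singleton_sdiff (hfM : f ∈ M) (hgM : g ∈ M) : insert g (ω \ {f}) \ M = ω \ M := by
  ext x
  simp only [mem_sdiff, mem_insert_iff, mem_singleton_iff]
  by_cases hxg : x = g
  · subst hxg; tauto
  · by_cases hxf : x = f
    · subst hxf; tauto
    · tauto

omit [Fintype V] in
/-- The partner of the exchanged configuration: `((ω ∖ {f}) ∪ {g}) ∆ M = ((ω ∆ M) ∖ {g}) ∪ {f}` for `f, g ∈ M`, `f ∈ ω`, `g ∉ ω`.
[folklore] -/
theorem insert_sdiff_singleton_symmDiff (hfM : f ∈ M) (hgM : g ∈ M) (hf : f ∈ ω) (hg : g ∉ ω) :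
    insert g (ω \ {f}) ∆ M = insert f ((ω ∆ M) \ {g}) := by
  have hgf : g ≠ f := fun h' => hg (h' ▸ hf)
  ext x
  simp only [Set.mem_symmDiff, mem_sdiff, mem_insert_iff, mem_singleton_iff]
  by_cases hxg : x = g
  · subst hxg; tauto
  · by_cases hxf : x = f
    · subst hxf; tauto
    · tauto

omit [Fintype V] in
/-- The exchange is undone by `ω' ↦ (ω' ∖ {g}) ∪ {f}` (`f ∈ ω`, `g ∉ ω`). [folklore] -/
theorem insert_sdiff_insert_sdiff_cancel (hf : f ∈ ω) (hg : g ∉ ω) : insert f (insert g (ω \ {f}) \ {g}) = ω := by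
  ext x
  simp only [mem_sdiff, mem_insert_iff, mem_singleton_iff]
  by_cases hxg : x = g
  · subst hxg
    constructor
    · rintro (rfl | ⟨-, h⟩)
      · exact hf
      · exact absurd rfl h
    · intro h; exact absurd h hg
  · by_cases hxf : x = f
    · subst hxf; tauto
    · tauto

end Exchange

/-! ### The triangle theorem -/

section Triangle

variable {M u₀ : BondConfig V} {o v y : V}

/-- **One exchange injection** (the common shape of both cases): for pairs `a = s(o, p) ∈ M` and `b ≠ a`,
`g = s(v, y) ∈ M`, the map `ω ↦ (ω ∖ {a}) ∪ {g}` injects the fibre pairs with `a, b ∈ ω ∈ Fo`, `ω ∆ M ∈ Fo`, `g ∉ ω`,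
`v ↮ y` in `ω ∖ {a}` and `o ↮ p` in `(ω ∆ M) ∖ {g}` into the pairs with `b, g ∈ ω' ∈ Fo`, `a ∈ ω' ∆ M ∈ Fo`.
[cite: Linusson2011, Prop. 2.6] [cite: Grimmett2006, §1.5 (p. 13)] -/
theorem fibreCount_exchange_le {a b : Sym2 V} {p : V} (ha : a = s(o, p)) (hop : o ≠ p) (hvy : v ≠ y)
    (haM : a ∈ M) (hgM : s(v, y) ∈ M) (hab : a ≠ b) :
    fibreCount M u₀ (forestEv V ∩ {ω | a ∈ ω ∧ b ∈ ω} ∩ {ω | s(v, y) ∉ ω ∧ ¬ (openGraph (ω \ {a})).Reachable v y ∧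
        ¬ (openGraph ((ω ∆ M) \ {s(v, y)})).Reachable o p}) (forestEv V) ≤
      fibreCount M u₀ (forestEv V ∩ {ω | b ∈ ω} ∩ {ω | s(v, y) ∈ ω}) (forestEv V ∩ {ω | a ∈ ω}) := by
  subst ha
  refine fibreCount_le_of_injOn (fun ω => insert s(v, y) (ω \ {s(o, p)})) (fun ω hω hA hB => ?_)
    (fun ω ω' hω hA hB hω' hA' hB' h => ?_)
  · obtain ⟨⟨hF, haω, hbω⟩, hgω, hvy', hop'⟩ := hA
    have hga : s(v, y) ∉ ω \ {s(o, p)} := fun h' => hgω h'.1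
    have haB : s(o, p) ∉ (ω ∆ M) \ {s(v, y)} := fun h' => by
      have := h'.1; rw [Set.mem_symmDiff] at this
      rcases this with ⟨-, h''⟩ | ⟨-, h''⟩
      · exact h'' haM
      · exact h'' haω
    refine ⟨by rw [insert_sdiff_singleton_sdiff haM hgM, hω], ⟨⟨?_, ?_⟩, mem_insert _ _⟩, ?_⟩
    · exact (isForestCfg_insert_iff hvy hga).2 ⟨isForestCfg_of_subset hF sdiff_subset, hvy'⟩
    · exact mem_insert_of_mem _ ⟨hbω, fun h' => hab (mem_singleton_iff.1 h').symm⟩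
    · rw [insert_sdiff_singleton_symmDiff haM hgM haω hgω]
      refine ⟨?_, mem_insert _ _⟩
      exact (isForestCfg_insert_iff hop haB).2 ⟨isForestCfg_of_subset hB sdiff_subset, hop'⟩
  · have h1 : insert s(o, p) (insert s(v, y) (ω \ {s(o, p)}) \ {s(v, y)}) = ω :=
      insert_sdiff_insert_sdiff_cancel hA.1.2.1 hA.2.1
    have h2 : insert s(o, p) (insert s(v, y) (ω' \ {s(o, p)}) \ {s(v, y)}) = ω' :=
      insert_sdiff_insert_sdiff_cancel hA'.1.2.1 hA'.2.1
    rw [← h1, ← h2, h]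

/-- **The triangle theorem, main case** (`e = ov, f = oy, g = vy ∈ M`, `o, v, y` distinct): on the fibre `(M, u₀)`,
`#(Fo ∩ {e, f ∈ ω}, Fo) ≤ #(Fo ∩ {e ∈ ω}, Fo ∩ {f ∈ ω})`.  Proof: `g ∈ ω ∆ M`; exchange `f ↔ g` when `o ↮ y` in `(ω ∆ M) ∖ {g}`,
else `e ↔ g`; count the two images, swap the second by `ω ↦ ω ∆ M`, and add. [cite: SempleWelsh2008, Conj. 1.1 (p. 2)]
[cite: Linusson2011, Prop. 2.6] [cite: Grimmett2006, §1.5 (p. 13)] -/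
theorem adjForestNoSq_fibre_of_triangle_mem (hov : o ≠ v) (hoy : o ≠ y) (hvy : v ≠ y)
    (heM : s(o, v) ∈ M) (hfM : s(o, y) ∈ M) (hgM : s(v, y) ∈ M) :
    fibreCount M u₀ (forestEv V ∩ {ω | s(o, v) ∈ ω ∧ s(o, y) ∈ ω}) (forestEv V) ≤
      fibreCount M u₀ (forestEv V ∩ {ω | s(o, v) ∈ ω}) (forestEv V ∩ {ω | s(o, y) ∈ ω}) := by
  have hef : s(o, v) ≠ s(o, y) := fun h' => hvy (Sym2.congr_right.1 h')
  -- the case split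
  set C : Set (BondConfig V) := {ω | ¬ (openGraph ((ω ∆ M) \ {s(v, y)})).Reachable o y} with hC
  set P : Set (BondConfig V) := forestEv V ∩ {ω | s(o, v) ∈ ω ∧ s(o, y) ∈ ω} with hP
  have hsplit : P = (P ∩ C) ∪ (P ∩ Cᶜ) := by rw [← inter_union_distrib_left, union_compl_self, inter_univ]
  have hdisj : Disjoint (P ∩ C) (P ∩ Cᶜ) := Set.disjoint_left.2 fun ω h₁ h₂ => h₂.2 h₁.2
  rw [hsplit, fibreCount_split_left _ _ _ hdisj]
  -- type 1: exchange `f ↔ g`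
  have h1 : fibreCount M u₀ (P ∩ C) (forestEv V) ≤
      fibreCount M u₀ (forestEv V ∩ {ω | s(o, v) ∈ ω} ∩ {ω | s(v, y) ∈ ω}) (forestEv V ∩ {ω | s(o, y) ∈ ω}) := by
    refine le_trans (fibreCount_mono_fibre M u₀ fun ω _ hA hB => ⟨?_, hB⟩)
      (fibreCount_exchange_le (a := s(o, y)) (b := s(o, v)) (p := y) rfl hoy hvy hfM hgM hef.symm)
    obtain ⟨⟨hF, he, hf⟩, hc⟩ := hA
    exact ⟨⟨hF, hf, he⟩, not_mem_of_isForestCfg_of_two_mem hov hoy hvy hF he hf,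
      not_reachable_sdiff_of_two_mem hov hoy hvy hF he hf, hc⟩
  -- type 2: exchange `e ↔ g`, then swap
  have h2 : fibreCount M u₀ (P ∩ Cᶜ) (forestEv V) ≤
      fibreCount M u₀ (forestEv V ∩ {ω | s(o, v) ∈ ω} ∩ {ω | s(v, y) ∉ ω}) (forestEv V ∩ {ω | s(o, y) ∈ ω}) := by
    have step : fibreCount M u₀ (P ∩ Cᶜ) (forestEv V) ≤
        fibreCount M u₀ (forestEv V ∩ {ω | s(o, y) ∈ ω} ∩ {ω | s(v, y) ∈ ω}) (forestEv V ∩ {ω | s(o, v) ∈ ω}) := by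
      refine le_trans (fibreCount_mono_fibre M u₀ fun ω _ hA hB => ⟨?_, hB⟩)
        (fibreCount_exchange_le (a := s(o, v)) (b := s(o, y)) (p := v) rfl hov hvy heM hgM hef)
      obtain ⟨⟨hF, he, hf⟩, hc⟩ := hA
      have hc' : (openGraph ((ω ∆ M) \ {s(v, y)})).Reachable o y := not_not.1 hc
      have hgB : s(v, y) ∈ ω ∆ M :=
        Set.mem_symmDiff.2 (Or.inr ⟨hgM, not_mem_of_isForestCfg_of_two_mem hov hoy hvy hF he hf⟩)
      have hvy' : ¬ (openGraph (ω \ {s(o, v)})).Reachable y v := not_reachable_sdiff_of_two_mem hoy hov hvy.symm hF hf he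
      exact ⟨⟨hF, he, hf⟩, not_mem_of_isForestCfg_of_two_mem hov hoy hvy hF he hf,
        fun h' => hvy' h'.symm, fun h' => not_reachable_both_sdiff hvy hB hgB h' hc'⟩
    refine le_trans step ?_
    rw [fibreCount_swap]
    refine fibreCount_mono_fibre M u₀ fun ω _ hA hB => ⟨⟨hA, fun h' => ?_⟩, hB.1⟩
    have hg2 : s(v, y) ∈ ω ∆ M := hB.2
    rw [Set.mem_symmDiff] at hg2
    rcases hg2 with ⟨-, h''⟩ | ⟨-, h''⟩
    · exact h'' hgM
    · exact h'' h'
  -- add up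
  have hsum : fibreCount M u₀ (forestEv V ∩ {ω | s(o, v) ∈ ω} ∩ {ω | s(v, y) ∈ ω}) (forestEv V ∩ {ω | s(o, y) ∈ ω}) +
      fibreCount M u₀ (forestEv V ∩ {ω | s(o, v) ∈ ω} ∩ {ω | s(v, y) ∉ ω}) (forestEv V ∩ {ω | s(o, y) ∈ ω}) =
      fibreCount M u₀ (forestEv V ∩ {ω | s(o, v) ∈ ω}) (forestEv V ∩ {ω | s(o, y) ∈ ω}) := by
    rw [← fibreCount_split_left _ _ _ (Set.disjoint_left.2 fun ω h₁ h₂ => h₂.2 h₁.2)]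
    congr 1
    ext ω
    simp only [mem_union, mem_inter_iff, mem_setOf_eq]
    tauto
  omega

/-- **THE TRIANGLE THEOREM**: the square-free adjacent forest Rayleigh inequality — `AdjForestRayleighNoSqOn`'s inequality — holds on
every fibre `(M, u₀)` whose pair set `M ∪ u₀` contains the third side `vy` of the triangle `o, v, y` (every multigraph in which
`v ~ y`, every vertex `o`, all other pairs arbitrary): `#(Fo ∩ {ov, oy ∈ ω}, Fo) ≤ #(Fo ∩ {ov ∈ ω}, Fo ∩ {oy ∈ ω})`.  In words: in
the uniform ordered two-forest partition of a finite multigraph, two pairs of a triangle are negatively correlated.  The loop,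
absent-pair and doubled-pair cases reduce to `0 ≤ ·` or to equalities exactly as in `adjForestRayleighNoSqOn_of_split`; a doubled
`vy` makes the left side vanish (a triangle in `ω`). [cite: SempleWelsh2008, Conj. 1.1 (p. 2); Thm. 4.2 (p. 11)]
[cite: Linusson2011, Prop. 2.6] [cite: Grimmett2006, §1.5 (p. 13)] -/
theorem adjForestNoSq_fibre_of_triangle (hd : Disjoint u₀ M) (hvy : v ≠ y) (hg : s(v, y) ∈ M ∨ s(v, y) ∈ u₀) :
    fibreCount M u₀ (forestEv V ∩ {ω | s(o, v) ∈ ω ∧ s(o, y) ∈ ω}) (forestEv V) ≤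
      fibreCount M u₀ (forestEv V ∩ {ω | s(o, v) ∈ ω}) (forestEv V ∩ {ω | s(o, y) ∈ ω}) := by
  -- loops: the left side vanishes
  by_cases hov : o = v
  · subst hov
    rw [fibreCount_eq_zero_of_forall _ _ _ _ fun ω _ hA _ =>
      not_mem_of_isForestCfg_of_isDiag hA.1 (Sym2.mk_isDiag_iff.2 rfl) hA.2.1]
    exact Nat.zero_le _
  by_cases hoy : o = y
  · subst hoy
    rw [fibreCount_eq_zero_of_forall _ _ _ _ fun ω _ hA _ =>
      not_mem_of_isForestCfg_of_isDiag hA.1 (Sym2.mk_isDiag_iff.2 rfl) hA.2.2]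
    exact Nat.zero_le _
  -- a pinned pair outside the fibre: the left side vanishes
  by_cases he : s(o, v) ∉ M ∧ s(o, v) ∉ u₀
  · rw [fibreCount_eq_zero_of_forall _ _ _ _ fun ω hω hA _ =>
      (mem_union_of_fibre hω hA.2.1).elim he.1 he.2]
    exact Nat.zero_le _
  by_cases hf : s(o, y) ∉ M ∧ s(o, y) ∉ u₀
  · rw [fibreCount_eq_zero_of_forall _ _ _ _ fun ω hω hA _ =>
      (mem_union_of_fibre hω hA.2.2).elim hf.1 hf.2]
    exact Nat.zero_le _
  rw [not_and_or, not_not, not_not] at he hf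
  have hdis : ∀ {g : Sym2 V}, g ∈ u₀ → g ∉ M := fun hg' hgM => Set.disjoint_left.1 hd hg' hgM
  rcases he with heM | heu
  · rcases hf with hfM | hfu
    · rcases hg with hgM | hgu
      · -- the main case
        exact adjForestNoSq_fibre_of_triangle_mem hov hoy hvy heM hfM hgM
      · -- `vy` doubled: every configuration of the fibre holds the triangle, so the left side vanishes
        rw [fibreCount_eq_zero_of_forall _ _ _ _ fun ω hω hA _ =>
          not_mem_of_isForestCfg_of_two_mem hov hoy hvy hA.1 hA.2.1 hA.2.2 (subset_of_fibre hω hgu)]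
        exact Nat.zero_le _
    · -- `e ∈ M`, `f ∈ u₀`: bad pairs are good pairs
      refine fibreCount_mono_fibre M u₀ fun ω hω hA hB => ?_
      have hfω : s(o, y) ∈ ω := subset_of_fibre hω hfu
      exact ⟨⟨hA.1, hA.2.1⟩, hB, Set.mem_symmDiff.2 (Or.inl ⟨hfω, hdis hfu⟩)⟩
  · have heM : s(o, v) ∉ M := hdis heu
    -- `e ∈ u₀`: the involution `ω ↦ ω ∆ M` maps bad pairs to good pairs
    refine le_trans (fibreCount_mono_fibre M u₀ (A' := forestEv V ∩ {ω | s(o, y) ∈ ω}) (B' := forestEv V ∩ {ω | s(o, v) ∈ ω})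
      fun ω hω hA hB => ?_) (le_of_eq (fibreCount_swap _ _ _ _))
    have heω : s(o, v) ∈ ω := subset_of_fibre hω heu
    exact ⟨⟨hA.1, hA.2.2⟩, hB, Set.mem_symmDiff.2 (Or.inl ⟨heω, heM⟩)⟩

/-- **Corollary (top fibre, vertex form)**: for a finite multigraph with pair set `E ∋ vy` (no doubled pairs), the number of ordered
two-forest partitions `(A, E ∖ A)` with `ov, oy ∈ A` is at most the number with `ov ∈ A`, `oy ∈ E ∖ A`.
[cite: SempleWelsh2008, Conj. 1.1 (p. 2)] [cite: Linusson2011, Prop. 2.6] -/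
theorem adjForestNoSq_top_of_triangle (E : BondConfig V) (hvy : v ≠ y) (hg : s(v, y) ∈ E) :
    fibreCount E ∅ (forestEv V ∩ {ω | s(o, v) ∈ ω ∧ s(o, y) ∈ ω}) (forestEv V) ≤
      fibreCount E ∅ (forestEv V ∩ {ω | s(o, v) ∈ ω}) (forestEv V ∩ {ω | s(o, y) ∈ ω}) :=
  adjForestNoSq_fibre_of_triangle (Set.empty_disjoint _) hvy (Or.inl hg)

end Triangle

end FK
end Summit.CriticalPhenomena.PercolationContinuityZ3.Theorems

end
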